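import Literature.Geometry.Kaehler.ComplexTorusNonSimpleAbelianFivefoldConditionD
import Literature.Geometry.Kaehler.ComplexTorusSimpleAbelianFivefoldFourCases
import HarnessLib

/-!
# Moonen–Zarhin 1999, dimension 5, IN ONE STATEMENT: `ℬ•(Xⁿ) = 𝒟•(Xⁿ)` and `Hg(X) = Sp_D(V,φ)` for every polarised complex
# abelian FIVEFOLD outside the four residual classes (non-simple: a simple fourfold factor, the forms (e) ∕ (f); simple:
# `End⁰(X) = ℚ`, an imaginary quadratic `End⁰(X)` of signature `(3,2)`)

Layer `Literature/Geometry/Kaehler`, namespace `Literature.Geometry.Kaehler.ComplexTorus`; lane `lit-hodgefound` (Track 2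
foundations library), Layer A4, prover seat `lit-hodgefound-p17` (generation 56), self-proposed row g56-#5 — the ASSEMBLY of
✔ g55-#13 (`ComplexTorusNonSimpleAbelianFivefoldConditionD` §5: Thm. (0.2) (4) for NON-SIMPLE fivefolds with only Moonen–Zarhin's
hypotheses) and ✔ g56-#4 (`ComplexTorusSimpleAbelianFivefoldFourCases` §3: (2.6) ∕ Thm. (2.7) at `g = 5` for SIMPLE fivefolds
outside type I(1) and the signature `(3,2)`).  THEOREMS ONLY (no definition, no instance, no notation, no named fact; D-0026,
net debt 0).

## Source, VERBATIM (held `paper:arxiv-math_9901113`)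

B. J. J. Moonen, Yu. G. Zarhin [MoonenZarhin1999LowDim], Math. Ann. 315 (1999): Thm. (0.2) (p0001 L122 – p0002 L8): «Let `X`
be a complex abelian variety with `dim(X) = 5` … (4) Suppose we are not in one of the cases (e), (f) or (g). Then … In
particular, if `X` has no simple factor of dimension 4 then `Hg(X) = Sp_D(V,φ)` and `ℬ•(Xⁿ) = 𝒟•(Xⁿ)` for every `n ≥ 1`»;
§2 (p0005 L20–L23): «For `g := dim(X) ≤ 3` and `g = 5` we always find that `Hg(X) = Sp_D(V,φ)` … it follows that
`ℬ•(Xⁿ) = 𝒟•(Xⁿ)` for all `n`»; (2.6) ∕ Thm. (2.7) (p0006 L2–L11, Tankeev–Ribet: simple of prime dimension).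

## What is proved

* **`IsRiemannForm.forall_divisorClasses_powPeriod_eq_hodgeClasses_of_finrank_eq_five_of_forall_not_isIsogenous_of_forall_isEmpty_of_isSimple_imp`**
  — `(X, η)` a polarised complex torus of dimension `5` (`κ` non-empty, automatic at `g = 5`) such that (non-simple side, Moonen–Zarhin's hypotheses of (0.2) (4))
  `h4`: no simple abelian fourfold isogeny factor, `hef`: not of the forms (e) ∕ (f), and (simple side, the two
  classification-bound cases of Thm. (2.7) excluded) `hS`: if `X` is simple then `End⁰(X) ≠ ℚ` and no complex embedding of the
  centre of `End⁰(X)` has tangent multiplicity `2`; then `ℬ•(Xᵏ) = 𝒟•(Xᵏ)` for all `k, p`;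
  `IsRiemannForm.hodgeGroup_eq_lefschetzGroup_of_finrank_eq_five_…` («`Hg(X) = Sp_D(V,φ)`»), and the isogeny form.
  `-- TODO(general form): the two simple residual cases (type I(1): minuscule weights; signature (3,2): Gabber ∕ Serre).`
-/

noncomputable section

open scoped Matrix
open Module Matrix NormedSpace NumberField

namespace Literature.Geometry.Kaehler

namespace ComplexTorus

section Fivefold

variable {κ : Type} [Fintype κ] [DecidableEq κ] [Nonempty κ] {E : Type} [NormedAddCommGroup E] [NormedSpace ℂ E]
  [FiniteDimensional ℂ E] {Ψ : (κ → ℝ) ≃L[ℝ] E} {η : E [⋀^Fin 2]→L[ℝ] ℝ}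

/-- **MOONEN–ZARHIN 1999 IN DIMENSION 5, ONE STATEMENT: `ℬ•(Xᵏ) = 𝒟•(Xᵏ)` for all `k, p`** for a polarised complex abelian
fivefold `X` which (if non-simple) has no simple fourfold isogeny factor and is not of the forms (e) ∕ (f), and (if simple) has
`End⁰(X) ≠ ℚ` and no centre embedding of tangent multiplicity `2` — Thm. (0.2) (4) «if `X` has no simple factor of dimension 4
then … `ℬ•(Xⁿ) = 𝒟•(Xⁿ)` for every `n ≥ 1`» (✔ g55-#13) together with (2.6) ∕ Thm. (2.7) at `g = 5` in the cases I(5),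
IV(5,·), IV(1) `(4,1)` (✔ g56-#4). [cite: MoonenZarhin1999LowDim, Thm. (0.2) (4) (p0002 L1–L8), §2 (p0005 L20–L23), (2.6) and Thm. (2.7) (p0006 L2–L11)]
[cite: Gordon1997, 1.13.3, Thm. 6.3 and Corollary] -/
theorem IsRiemannForm.forall_divisorClasses_powPeriod_eq_hodgeClasses_of_finrank_eq_five_of_forall_not_isIsogenous_of_forall_isEmpty_of_isSimple_imp
    (hη : IsRiemannForm Ψ η) (h5 : finrank ℂ E = 5)
    (h4 : ∀ {κ' : Type} [Fintype κ'] [DecidableEq κ'] {E' : Type} [NormedAddCommGroup E'] [NormedSpace ℂ E']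
      [FiniteDimensional ℂ E'] {Ψ' : (κ' → ℝ) ≃L[ℝ] E'} {η' : E' [⋀^Fin 2]→L[ℝ] ℝ}, IsRiemannForm Ψ' η' →
      finrank ℂ E' = 4 → IsSimple Ψ' → ∀ {τ : ℂ} (hτ : τ.im ≠ 0), ¬ IsIsogenous Ψ (prodPeriod Ψ' (ellipticPeriod hτ)))
    (hef : ∀ {κ' : Type} [Fintype κ'] [DecidableEq κ'] {E' : Type} [NormedAddCommGroup E'] [NormedSpace ℂ E']
      [FiniteDimensional ℂ E'] {Ψ' : (κ' → ℝ) ≃L[ℝ] E'} {η' : E' [⋀^Fin 2]→L[ℝ] ℝ}, IsRiemannForm Ψ' η' →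
      finrank ℂ E' = 3 → IsSimple Ψ' → ∀ {σ : ℂ} (hσ : σ.im ≠ 0) {ρ : ℂ} (hρ : ρ.im ≠ 0),
      IsIsogenous Ψ (prodPeriod (prodPeriod Ψ' (ellipticPeriod hσ)) (ellipticPeriod hρ)) → ellipticEnd hρ ≠ ⊥ →
      IsEmpty (Algebra.adjoin ℚ {ρ} →ₐ[ℚ] endAlgRat Ψ'))
    (hS : ∀ hX : IsSimple Ψ, endAlgRat Ψ ≠ ⊥ ∧ ∀ σ : centerField Ψ hX →+* ℂ, finrank ℂ ↥(⨅ y : centerField Ψ hX,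
      Module.End.eigenspace ((analyticRepHom Ψ ⟨centerField.valAlgHom Ψ hX y, centerField.val_mem Ψ hX y⟩ : E →L[ℂ] E) :
        E →ₗ[ℂ] E) (σ y)) ≠ 2) :
    ∀ k p, divisorClasses (powPeriod Ψ k) p = hodgeClasses (powPeriod Ψ k) p := by
  by_cases hX : IsSimple Ψ
  · exact hX.forall_divisorClasses_powPeriod_eq_hodgeClasses_of_finrank_eq_five_of_endAlgRat_ne_bot_of_forall_ne_two hη h5
      (hS hX).1 (hS hX).2
  · exact hη.forall_divisorClasses_powPeriod_eq_hodgeClasses_of_not_isSimple_of_finrank_eq_five_of_forall_not_isIsogenous_of_forall_isEmpty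
      h5 hX h4 hef

/-- **«`Hg(X) = Sp_D(V,φ)`» for the same fivefolds** (real points: `Hg(X)(ℝ) = S(X)(ℝ)`), from (D) by Gordon's Thm. 7.5 (1) ⟹ (2).
[cite: MoonenZarhin1999LowDim, Thm. (0.2) (4) (p0002 L5–L8) and §2 (2.6)] [cite: Gordon1999HodgeAVSurvey, Thm. 7.5 (1) ⟺ (2)]
[cite: Milne1999LefschetzClasses, §4 Prop. 4.8] -/
theorem IsRiemannForm.hodgeGroup_eq_lefschetzGroup_of_finrank_eq_five_of_forall_not_isIsogenous_of_forall_isEmpty_of_isSimple_imp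
    (hη : IsRiemannForm Ψ η) (h5 : finrank ℂ E = 5)
    (h4 : ∀ {κ' : Type} [Fintype κ'] [DecidableEq κ'] {E' : Type} [NormedAddCommGroup E'] [NormedSpace ℂ E']
      [FiniteDimensional ℂ E'] {Ψ' : (κ' → ℝ) ≃L[ℝ] E'} {η' : E' [⋀^Fin 2]→L[ℝ] ℝ}, IsRiemannForm Ψ' η' →
      finrank ℂ E' = 4 → IsSimple Ψ' → ∀ {τ : ℂ} (hτ : τ.im ≠ 0), ¬ IsIsogenous Ψ (prodPeriod Ψ' (ellipticPeriod hτ)))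
    (hef : ∀ {κ' : Type} [Fintype κ'] [DecidableEq κ'] {E' : Type} [NormedAddCommGroup E'] [NormedSpace ℂ E']
      [FiniteDimensional ℂ E'] {Ψ' : (κ' → ℝ) ≃L[ℝ] E'} {η' : E' [⋀^Fin 2]→L[ℝ] ℝ}, IsRiemannForm Ψ' η' →
      finrank ℂ E' = 3 → IsSimple Ψ' → ∀ {σ : ℂ} (hσ : σ.im ≠ 0) {ρ : ℂ} (hρ : ρ.im ≠ 0),
      IsIsogenous Ψ (prodPeriod (prodPeriod Ψ' (ellipticPeriod hσ)) (ellipticPeriod hρ)) → ellipticEnd hρ ≠ ⊥ →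
      IsEmpty (Algebra.adjoin ℚ {ρ} →ₐ[ℚ] endAlgRat Ψ'))
    (hS : ∀ hX : IsSimple Ψ, endAlgRat Ψ ≠ ⊥ ∧ ∀ σ : centerField Ψ hX →+* ℂ, finrank ℂ ↥(⨅ y : centerField Ψ hX,
      Module.End.eigenspace ((analyticRepHom Ψ ⟨centerField.valAlgHom Ψ hX y, centerField.val_mem Ψ hX y⟩ : E →L[ℂ] E) :
        E →ₗ[ℂ] E) (σ y)) ≠ 2) :
    hodgeGroup Ψ = lefschetzGroup Ψ η := by
  obtain ⟨G, hG⟩ := hη.exists_ratMatrix_latticeGram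
  exact ((hη.forall_divisorClasses_powPeriod_eq_hodgeClasses_iff_eq_and_hodgeGroup_eq_lefschetzGroup hG (by omega)).1
    (hη.forall_divisorClasses_powPeriod_eq_hodgeClasses_of_finrank_eq_five_of_forall_not_isIsogenous_of_forall_isEmpty_of_isSimple_imp
      h5 h4 hef hS)).2

end Fivefold

section FivefoldIsogenous

variable {ι : Type*} [Fintype ι] [DecidableEq ι] {F : Type*} [NormedAddCommGroup F] [NormedSpace ℂ F] {Φ : (ι → ℝ) ≃L[ℝ] F}
  {κ : Type} [Fintype κ] [DecidableEq κ] [Nonempty κ] {E : Type} [NormedAddCommGroup E] [NormedSpace ℂ E]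
  [FiniteDimensional ℂ E] {Ψ : (κ → ℝ) ≃L[ℝ] E} {η : E [⋀^Fin 2]→L[ℝ] ℝ}

/-- **Every complex torus isogenous to such a fivefold satisfies (D).**
[cite: MoonenZarhin1999LowDim, Thm. (0.2) (4) (p0002 L1–L8) and §2 (2.6)] [cite: Lange2023AbelianVarietiesComplex, §1.1.2 Cor. 1.1.16] -/
theorem IsIsogenous.forall_divisorClasses_powPeriod_eq_hodgeClasses_of_finrank_eq_five_of_forall_not_isIsogenous_of_forall_isEmpty_of_isSimple_imp
    (hiso : IsIsogenous Φ Ψ) (hη : IsRiemannForm Ψ η) (h5 : finrank ℂ E = 5)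
    (h4 : ∀ {κ' : Type} [Fintype κ'] [DecidableEq κ'] {E' : Type} [NormedAddCommGroup E'] [NormedSpace ℂ E']
      [FiniteDimensional ℂ E'] {Ψ' : (κ' → ℝ) ≃L[ℝ] E'} {η' : E' [⋀^Fin 2]→L[ℝ] ℝ}, IsRiemannForm Ψ' η' →
      finrank ℂ E' = 4 → IsSimple Ψ' → ∀ {τ : ℂ} (hτ : τ.im ≠ 0), ¬ IsIsogenous Ψ (prodPeriod Ψ' (ellipticPeriod hτ)))
    (hef : ∀ {κ' : Type} [Fintype κ'] [DecidableEq κ'] {E' : Type} [NormedAddCommGroup E'] [NormedSpace ℂ E']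
      [FiniteDimensional ℂ E'] {Ψ' : (κ' → ℝ) ≃L[ℝ] E'} {η' : E' [⋀^Fin 2]→L[ℝ] ℝ}, IsRiemannForm Ψ' η' →
      finrank ℂ E' = 3 → IsSimple Ψ' → ∀ {σ : ℂ} (hσ : σ.im ≠ 0) {ρ : ℂ} (hρ : ρ.im ≠ 0),
      IsIsogenous Ψ (prodPeriod (prodPeriod Ψ' (ellipticPeriod hσ)) (ellipticPeriod hρ)) → ellipticEnd hρ ≠ ⊥ →
      IsEmpty (Algebra.adjoin ℚ {ρ} →ₐ[ℚ] endAlgRat Ψ'))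
    (hS : ∀ hX : IsSimple Ψ, endAlgRat Ψ ≠ ⊥ ∧ ∀ σ : centerField Ψ hX →+* ℂ, finrank ℂ ↥(⨅ y : centerField Ψ hX,
      Module.End.eigenspace ((analyticRepHom Ψ ⟨centerField.valAlgHom Ψ hX y, centerField.val_mem Ψ hX y⟩ : E →L[ℂ] E) :
        E →ₗ[ℂ] E) (σ y)) ≠ 2) :
    ∀ k p, divisorClasses (powPeriod Φ k) p = hodgeClasses (powPeriod Φ k) p :=
  hiso.forall_powPeriod_divisorClasses_eq_hodgeClasses_iff.2
    (hη.forall_divisorClasses_powPeriod_eq_hodgeClasses_of_finrank_eq_five_of_forall_not_isIsogenous_of_forall_isEmpty_of_isSimple_imp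
      h5 h4 hef hS)

end FivefoldIsogenous

end ComplexTorus

end Literature.Geometry.Kaehler
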